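import Summits.CriticalPhenomena.PercolationContinuityZ3.Theorems.PercNearOneGluingNoHeavyLowerTailSahiMixtureHMixFour

/-!
# H-MIX(4), infrastructure I: the sixteen Venn atoms of four events, moments as atom sums, and the three-slot cell from its four
# Bernstein coefficients

Support file of the one-cut programme (crux `NoHeavyLowerTail`, stmt-CriticalPhenomena-4575; cell `prim-masterthm`, seat P3, gen 7;
`run/shared/lean/prim/prim-masterthm/prim-masterthm-p3/HIERARCHY.md` §13–§14).  The hereditary mixture statement for FOUR events (H-MIX(4):
the ∩-closed family of a quadruple in the hereditary class `𝒦₄` stays Sahi-nonnegative at every order, Bernstein-positively, under OR-ing an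
independent coin into any sub-collection) reduces by `…SahiMixtureHMixFour` / `…SahiMixtureIrredundant` to finitely many cells; the generic
three-slot cell GC(3) being FALSE (`…SahiMixtureHereditaryRefutation`), the three-slot cells of four events must be certified one by one from the
hereditary rows of the four events (ttrl cp-mix, `run/shared/lean/ttrl/mix/certs/her3/`, MIXCOMB.md §16.1: degree-3 certificates with constant
multiplier over hereditary rows of order ≤ 3, all standalone-verified).  This file provides the common vocabulary of the replay:
* `atom4 A b₀ b₁ b₂ b₃` — the indicator of the Venn cell (`A_t` if `b_t`, else its complement), `exM_c` (`c < 16` the bitmask of an index set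
  `R ⊆ [4]`) — **`μ(⋂_{i∈R} A_i) = Σ_{C ⊇ R} μ(atom C)`** (pointwise ring identities), `sum_atom4` (total mass `1`);
* `ind_biInter_mul` — products of indicators of members of the ∩-closed family are indicators of members; `fam2/fam3` — slot families as vectors;
* `bernsteinPos_three_mixEv_of_coeffs` — the three-slot cell `E_3(μ⊗coin(h); mixEv P_j Q_j)` is Bernstein-positive as soon as its four
  unnormalised Bernstein coefficients `E_3(P), C₁, C₂, E_3(Q)` (`…SahiMixtureGenericCellThree.sahiE_three_mixEv_eq`) are nonnegative;
* `bernsteinPos_threeSlot_plain` — the PLAIN three-slot cells (every slot `A_K` untouched or fully OR-ed) are the three-event mixture cells of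
  `…SahiMixtureLawCells` on members of the ∩-closed family (no certificate needed).
HONEST FRAMING: infrastructure only; the cells themselves are in the companion files `…SahiMixtureFourCells*`. [this work]
-/

noncomputable section

open scoped Classical

namespace Summit.CriticalPhenomena.PercolationContinuityZ3.Theorems

open Finset Function
open Literature.Combinatorics.Sahi2008
open Literature.Probability.Percolation.BHK2006 (ind_le_one ind_inter)
open Literature.Probability.Percolation.DecisionTree (ind ind_of_mem ind_of_not_mem ind_nonneg)

namespace SahiMixture

/-! ### Members of the ∩-closed family: products and slot vectors -/

section Members

variable {α : Type*} [Fintype α] {n : ℕ} (A : Fin n → Set α)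

omit [Fintype α] in
/-- The empty intersection is everything. [folklore] -/
theorem biInter_finset_empty : (⋂ i ∈ (∅ : Finset (Fin n)), A i) = Set.univ := by
  ext a; simp

omit [Fintype α] in
/-- `ind Ω = 1`. [folklore] -/
theorem ind_univ_apply (a : α) : ind (Set.univ : Set α) a = 1 := ind_of_mem (Set.mem_univ a)

omit [Fintype α] in
/-- **Products of members are members**: `1_{A_R} · 1_{A_S} = 1_{A_{R∪S}}`. [folklore] -/
theorem ind_biInter_mul (R S : Finset (Fin n)) :
    ind (⋂ i ∈ R, A i) * ind (⋂ i ∈ S, A i) = ind (⋂ i ∈ R ∪ S, A i) := by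
  funext a
  rw [Finset.set_biInter_inter, Pi.mul_apply, ind_inter]

omit [Fintype α] in
/-- A two-slot family of members as a vector. [folklore] -/
theorem fam2 (R S : Finset (Fin n)) :
    (fun j => ind (⋂ i ∈ (![R, S] : Fin 2 → Finset (Fin n)) j, A i)) = ![ind (⋂ i ∈ R, A i), ind (⋂ i ∈ S, A i)] := by
  funext j; fin_cases j <;> rfl

omit [Fintype α] in
/-- A three-slot family of members as a vector. [folklore] -/
theorem fam3 (R S T : Finset (Fin n)) :
    (fun j => ind (⋂ i ∈ (![R, S, T] : Fin 3 → Finset (Fin n)) j, A i)) =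
      ![ind (⋂ i ∈ R, A i), ind (⋂ i ∈ S, A i), ind (⋂ i ∈ T, A i)] := by
  funext j; fin_cases j <;> rfl

omit [Fintype α] in
/-- A four-slot family of members as a vector. [folklore] -/
theorem fam4 (R S T U : Finset (Fin n)) :
    (fun j => ind (⋂ i ∈ (![R, S, T, U] : Fin 4 → Finset (Fin n)) j, A i)) =
      ![ind (⋂ i ∈ R, A i), ind (⋂ i ∈ S, A i), ind (⋂ i ∈ T, A i), ind (⋂ i ∈ U, A i)] := by
  funext j; fin_cases j <;> rfl

omit [Fintype α] in
/-- A three-slot family of members of the ∩-closed family of OR-mixed events, as a vector. [folklore] -/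
theorem fam3_orCoin (F : Fin n → Bool) (R S T : Finset (Fin n)) :
    (fun j => ind (⋂ i ∈ (![R, S, T] : Fin 3 → Finset (Fin n)) j, orCoin (A i) (F i))) =
      ![ind (⋂ i ∈ R, orCoin (A i) (F i)), ind (⋂ i ∈ S, orCoin (A i) (F i)), ind (⋂ i ∈ T, orCoin (A i) (F i))] := by
  funext j; fin_cases j <;> rfl

end Members

/-! ### The sixteen Venn atoms of four events -/

section Atoms

variable {α : Type*} [Fintype α]

/-- A literal: the value itself or its complement to `1`. [folklore] -/
def lit (b : Bool) (t : ℝ) : ℝ := bif b then t else 1 - t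

/-- The indicator of the Venn cell of four events with occurrence pattern `(b₀,b₁,b₂,b₃)`: `Π_t (1_{A_t} if b_t else 1 − 1_{A_t})`. [folklore] -/
def atom4 (A : Fin 4 → Set α) (b0 b1 b2 b3 : Bool) : α → ℝ :=
  fun a => lit b0 (ind (A 0) a) * lit b1 (ind (A 1) a) * lit b2 (ind (A 2) a) * lit b3 (ind (A 3) a)

omit [Fintype α] in
/-- Literals of indicators are nonnegative. [folklore] -/
theorem lit_ind_nonneg (b : Bool) (X : Set α) (a : α) : 0 ≤ lit b (ind X a) := by
  cases b
  · exact sub_nonneg.2 (ind_le_one X a)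
  · exact ind_nonneg X a

/-- Atoms have nonnegative mass. [folklore] -/
theorem ex_atom4_nonneg {μ : α → ℝ} (hμ : ∀ a, 0 ≤ μ a) (A : Fin 4 → Set α) (b0 b1 b2 b3 : Bool) :
    0 ≤ ex μ (atom4 A b0 b1 b2 b3) :=
  ex_nonneg hμ fun a => mul_nonneg (mul_nonneg (mul_nonneg (lit_ind_nonneg _ _ a) (lit_ind_nonneg _ _ a)) (lit_ind_nonneg _ _ a))
    (lit_ind_nonneg _ _ a)

variable (μ : α → ℝ) (A : Fin 4 → Set α)


/-- `μ(Ω)` as the sum of the atoms above it. [this work] -/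
theorem exM_0 : ex μ (ind (⋂ i ∈ (∅ : Finset (Fin 4)), A i)) =
    ex μ (atom4 A false false false false) + ex μ (atom4 A true false false false) + ex μ (atom4 A false true false false) + ex μ (atom4 A true true false false) + ex μ (atom4 A false false true false) + ex μ (atom4 A true false true false) + ex μ (atom4 A false true true false) + ex μ (atom4 A true true true false) + ex μ (atom4 A false false false true) + ex μ (atom4 A true false false true) + ex μ (atom4 A false true false true) + ex μ (atom4 A true true false true) + ex μ (atom4 A false false true true) + ex μ (atom4 A true false true true) + ex μ (atom4 A false true true true) + ex μ (atom4 A true true true true) := by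
  try simp only [← ex_add]
  congr 1
  funext a
  simp only [biInter_finset_empty, ind_univ_apply, Pi.add_apply, atom4, lit, cond_true, cond_false]
  ring

/-- `μ(A_0)` as the sum of the atoms above it. [this work] -/
theorem exM_1 : ex μ (ind (⋂ i ∈ ({0} : Finset (Fin 4)), A i)) =
    ex μ (atom4 A true false false false) + ex μ (atom4 A true true false false) + ex μ (atom4 A true false true false) + ex μ (atom4 A true true true false) + ex μ (atom4 A true false false true) + ex μ (atom4 A true true false true) + ex μ (atom4 A true false true true) + ex μ (atom4 A true true true true) := by
  try simp only [← ex_add]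
  congr 1
  funext a
  simp only [Finset.set_biInter_singleton, Pi.add_apply, atom4, lit, cond_true, cond_false]
  ring

/-- `μ(A_1)` as the sum of the atoms above it. [this work] -/
theorem exM_2 : ex μ (ind (⋂ i ∈ ({1} : Finset (Fin 4)), A i)) =
    ex μ (atom4 A false true false false) + ex μ (atom4 A true true false false) + ex μ (atom4 A false true true false) + ex μ (atom4 A true true true false) + ex μ (atom4 A false true false true) + ex μ (atom4 A true true false true) + ex μ (atom4 A false true true true) + ex μ (atom4 A true true true true) := by
  try simp only [← ex_add]
  congr 1
  funext a
  simp only [Finset.set_biInter_singleton, Pi.add_apply, atom4, lit, cond_true, cond_false]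
  ring

/-- `μ(A_0⋂A_1)` as the sum of the atoms above it. [this work] -/
theorem exM_3 : ex μ (ind (⋂ i ∈ ({0, 1} : Finset (Fin 4)), A i)) =
    ex μ (atom4 A true true false false) + ex μ (atom4 A true true true false) + ex μ (atom4 A true true false true) + ex μ (atom4 A true true true true) := by
  try simp only [← ex_add]
  congr 1
  funext a
  simp only [Finset.set_biInter_insert, Finset.set_biInter_singleton, ind_inter, Pi.add_apply, atom4, lit, cond_true, cond_false]
  ring

/-- `μ(A_2)` as the sum of the atoms above it. [this work] -/
theorem exM_4 : ex μ (ind (⋂ i ∈ ({2} : Finset (Fin 4)), A i)) =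
    ex μ (atom4 A false false true false) + ex μ (atom4 A true false true false) + ex μ (atom4 A false true true false) + ex μ (atom4 A true true true false) + ex μ (atom4 A false false true true) + ex μ (atom4 A true false true true) + ex μ (atom4 A false true true true) + ex μ (atom4 A true true true true) := by
  try simp only [← ex_add]
  congr 1
  funext a
  simp only [Finset.set_biInter_singleton, Pi.add_apply, atom4, lit, cond_true, cond_false]
  ring

/-- `μ(A_0⋂A_2)` as the sum of the atoms above it. [this work] -/
theorem exM_5 : ex μ (ind (⋂ i ∈ ({0, 2} : Finset (Fin 4)), A i)) =
    ex μ (atom4 A true false true false) + ex μ (atom4 A true true true false) + ex μ (atom4 A true false true true) + ex μ (atom4 A true true true true) := by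
  try simp only [← ex_add]
  congr 1
  funext a
  simp only [Finset.set_biInter_insert, Finset.set_biInter_singleton, ind_inter, Pi.add_apply, atom4, lit, cond_true, cond_false]
  ring

/-- `μ(A_1⋂A_2)` as the sum of the atoms above it. [this work] -/
theorem exM_6 : ex μ (ind (⋂ i ∈ ({1, 2} : Finset (Fin 4)), A i)) =
    ex μ (atom4 A false true true false) + ex μ (atom4 A true true true false) + ex μ (atom4 A false true true true) + ex μ (atom4 A true true true true) := by
  try simp only [← ex_add]
  congr 1
  funext a
  simp only [Finset.set_biInter_insert, Finset.set_biInter_singleton, ind_inter, Pi.add_apply, atom4, lit, cond_true, cond_false]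
  ring

/-- `μ(A_0⋂A_1⋂A_2)` as the sum of the atoms above it. [this work] -/
theorem exM_7 : ex μ (ind (⋂ i ∈ ({0, 1, 2} : Finset (Fin 4)), A i)) =
    ex μ (atom4 A true true true false) + ex μ (atom4 A true true true true) := by
  try simp only [← ex_add]
  congr 1
  funext a
  simp only [Finset.set_biInter_insert, Finset.set_biInter_singleton, ind_inter, Pi.add_apply, atom4, lit, cond_true, cond_false]
  ring

/-- `μ(A_3)` as the sum of the atoms above it. [this work] -/
theorem exM_8 : ex μ (ind (⋂ i ∈ ({3} : Finset (Fin 4)), A i)) =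
    ex μ (atom4 A false false false true) + ex μ (atom4 A true false false true) + ex μ (atom4 A false true false true) + ex μ (atom4 A true true false true) + ex μ (atom4 A false false true true) + ex μ (atom4 A true false true true) + ex μ (atom4 A false true true true) + ex μ (atom4 A true true true true) := by
  try simp only [← ex_add]
  congr 1
  funext a
  simp only [Finset.set_biInter_singleton, Pi.add_apply, atom4, lit, cond_true, cond_false]
  ring

/-- `μ(A_0⋂A_3)` as the sum of the atoms above it. [this work] -/
theorem exM_9 : ex μ (ind (⋂ i ∈ ({0, 3} : Finset (Fin 4)), A i)) =
    ex μ (atom4 A true false false true) + ex μ (atom4 A true true false true) + ex μ (atom4 A true false true true) + ex μ (atom4 A true true true true) := by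
  try simp only [← ex_add]
  congr 1
  funext a
  simp only [Finset.set_biInter_insert, Finset.set_biInter_singleton, ind_inter, Pi.add_apply, atom4, lit, cond_true, cond_false]
  ring

/-- `μ(A_1⋂A_3)` as the sum of the atoms above it. [this work] -/
theorem exM_10 : ex μ (ind (⋂ i ∈ ({1, 3} : Finset (Fin 4)), A i)) =
    ex μ (atom4 A false true false true) + ex μ (atom4 A true true false true) + ex μ (atom4 A false true true true) + ex μ (atom4 A true true true true) := by
  try simp only [← ex_add]
  congr 1
  funext a
  simp only [Finset.set_biInter_insert, Finset.set_biInter_singleton, ind_inter, Pi.add_apply, atom4, lit, cond_true, cond_false]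
  ring

/-- `μ(A_0⋂A_1⋂A_3)` as the sum of the atoms above it. [this work] -/
theorem exM_11 : ex μ (ind (⋂ i ∈ ({0, 1, 3} : Finset (Fin 4)), A i)) =
    ex μ (atom4 A true true false true) + ex μ (atom4 A true true true true) := by
  try simp only [← ex_add]
  congr 1
  funext a
  simp only [Finset.set_biInter_insert, Finset.set_biInter_singleton, ind_inter, Pi.add_apply, atom4, lit, cond_true, cond_false]
  ring

/-- `μ(A_2⋂A_3)` as the sum of the atoms above it. [this work] -/
theorem exM_12 : ex μ (ind (⋂ i ∈ ({2, 3} : Finset (Fin 4)), A i)) =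
    ex μ (atom4 A false false true true) + ex μ (atom4 A true false true true) + ex μ (atom4 A false true true true) + ex μ (atom4 A true true true true) := by
  try simp only [← ex_add]
  congr 1
  funext a
  simp only [Finset.set_biInter_insert, Finset.set_biInter_singleton, ind_inter, Pi.add_apply, atom4, lit, cond_true, cond_false]
  ring

/-- `μ(A_0⋂A_2⋂A_3)` as the sum of the atoms above it. [this work] -/
theorem exM_13 : ex μ (ind (⋂ i ∈ ({0, 2, 3} : Finset (Fin 4)), A i)) =
    ex μ (atom4 A true false true true) + ex μ (atom4 A true true true true) := by
  try simp only [← ex_add]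
  congr 1
  funext a
  simp only [Finset.set_biInter_insert, Finset.set_biInter_singleton, ind_inter, Pi.add_apply, atom4, lit, cond_true, cond_false]
  ring

/-- `μ(A_1⋂A_2⋂A_3)` as the sum of the atoms above it. [this work] -/
theorem exM_14 : ex μ (ind (⋂ i ∈ ({1, 2, 3} : Finset (Fin 4)), A i)) =
    ex μ (atom4 A false true true true) + ex μ (atom4 A true true true true) := by
  try simp only [← ex_add]
  congr 1
  funext a
  simp only [Finset.set_biInter_insert, Finset.set_biInter_singleton, ind_inter, Pi.add_apply, atom4, lit, cond_true, cond_false]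
  ring

/-- `μ(A_0⋂A_1⋂A_2⋂A_3)` as the sum of the atoms above it. [this work] -/
theorem exM_15 : ex μ (ind (⋂ i ∈ ({0, 1, 2, 3} : Finset (Fin 4)), A i)) =
    ex μ (atom4 A true true true true) := by
  try simp only [← ex_add]
  congr 1
  funext a
  simp only [Finset.set_biInter_insert, Finset.set_biInter_singleton, ind_inter, atom4, lit, cond_true]
  ring

/-- **The atoms have total mass one.** [folklore] -/
theorem sum_atom4 (hμ1 : ∑ a, μ a = 1) :
    ex μ (atom4 A false false false false) + ex μ (atom4 A true false false false) + ex μ (atom4 A false true false false) + ex μ (atom4 A true true false false) + ex μ (atom4 A false false true false) + ex μ (atom4 A true false true false) + ex μ (atom4 A false true true false) + ex μ (atom4 A true true true false) + ex μ (atom4 A false false false true) + ex μ (atom4 A true false false true) + ex μ (atom4 A false true false true) + ex μ (atom4 A true true false true) + ex μ (atom4 A false false true true) + ex μ (atom4 A true false true true) + ex μ (atom4 A false true true true) + ex μ (atom4 A true true true true) = 1 := by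
  rw [← exM_0 μ A, biInter_finset_empty]
  exact (congrArg (ex μ) (funext fun a => ind_univ_apply a)).trans (ex_one hμ1)

end Atoms

/-! ### The three-slot cell from its four Bernstein coefficients -/

section Coeffs

variable {α : Type*} [Fintype α] {μ : α → ℝ} (P0 P1 P2 Q0 Q1 Q2 : Set α)

/-- **The three-slot cell is Bernstein-positive as soon as its four unnormalised Bernstein coefficients are nonnegative** (the coefficients being those
of `sahiE_three_mixEv_eq`: `E_3(P)`, `C₁`, `C₂`, `E_3(Q)`). [this work] -/
theorem bernsteinPos_three_mixEv_of_coeffs (hc0 : 0 ≤ sahiE μ 3 ![ind P0, ind P1, ind P2])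
    (hc1 : 0 ≤ ex μ (ind P0) * ex μ (ind P1) * ex μ (ind Q2) + ex μ (ind P0) * ex μ (ind P2) * ex μ (ind Q1) + (-1) * ex μ (ind P0) * ex μ (ind P1 * ind P2) + (-1) * ex μ (ind P0) * ex μ (ind Q1 * ind Q2) + ex μ (ind P1) * ex μ (ind P2) * ex μ (ind Q0) + (-1) * ex μ (ind P1) * ex μ (ind P0 * ind P2) + (-1) * ex μ (ind P1) * ex μ (ind Q0 * ind Q2) + (-1) * ex μ (ind P0 * ind P1) * ex μ (ind P2) + (-1) * ex μ (ind P0 * ind P1) * ex μ (ind Q2) + (-1) * ex μ (ind P2) * ex μ (ind Q0 * ind Q1) + (-1) * ex μ (ind P0 * ind P2) * ex μ (ind Q1) + (-1) * ex μ (ind P1 * ind P2) * ex μ (ind Q0) + 4 * ex μ (ind P0 * ind P1 * ind P2) + 2 * ex μ (ind Q0 * ind Q1 * ind Q2))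
    (hc2 : 0 ≤ ex μ (ind P0) * ex μ (ind Q1) * ex μ (ind Q2) + (-1) * ex μ (ind P0) * ex μ (ind Q1 * ind Q2) + ex μ (ind P1) * ex μ (ind Q0) * ex μ (ind Q2) + (-1) * ex μ (ind P1) * ex μ (ind Q0 * ind Q2) + (-1) * ex μ (ind P0 * ind P1) * ex μ (ind Q2) + ex μ (ind P2) * ex μ (ind Q0) * ex μ (ind Q1) + (-1) * ex μ (ind P2) * ex μ (ind Q0 * ind Q1) + (-1) * ex μ (ind P0 * ind P2) * ex μ (ind Q1) + (-1) * ex μ (ind P1 * ind P2) * ex μ (ind Q0) + 2 * ex μ (ind P0 * ind P1 * ind P2) + (-1) * ex μ (ind Q0) * ex μ (ind Q1 * ind Q2) + (-1) * ex μ (ind Q1) * ex μ (ind Q0 * ind Q2) + (-1) * ex μ (ind Q0 * ind Q1) * ex μ (ind Q2) + 4 * ex μ (ind Q0 * ind Q1 * ind Q2))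
    (hc3 : 0 ≤ sahiE μ 3 ![ind Q0, ind Q1, ind Q2]) :
    BernsteinPos 3 (fun h => sahiE (coinWeight μ h) 3 ![ind (mixEv P0 Q0), ind (mixEv P1 Q1), ind (mixEv P2 Q2)]) :=
  ((((bp_g3.smul hc0).add (bp_hg2.smul hc1)).add (bp_h2g.smul hc2)).add (bp_h3.smul hc3)).congr fun h _ _ => by
    rw [sahiE_three_mixEv_eq P0 P1 P2 Q0 Q1 Q2 h]
    ring

end Coeffs

/-! ### The plain three-slot cells: no certificate needed -/

section Plain

variable {α : Type*} [Fintype α] {n : ℕ} (A : Fin n → Set α) (F : Fin n → Bool)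

omit [Fintype α] in
/-- `mixEv P P` is `P` off and on the coin: the untouched member. [this work] -/
theorem mixEv_self (P : Set α) : mixEv P P = orCoin P false := by
  ext x; obtain ⟨a, ξ⟩ := x; cases ξ <;> simp [mixEv, orCoin]

omit [Fintype α] in
/-- `mixEv P Ω` is the fully OR-ed member `P ∪ H`. [this work] -/
theorem mixEv_univ (P : Set α) : mixEv P Set.univ = orCoin P true := by
  ext x; obtain ⟨a, ξ⟩ := x; cases ξ <;> simp [mixEv, orCoin]

omit [Fintype α] in
/-- A member none of whose events is mixed stays untouched. [this work] -/
theorem biInter_orCoin_of_forall_false (K : Finset (Fin n)) (hF : ∀ i ∈ K, F i = false) :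
    (⋂ i ∈ K, orCoin (A i) (F i)) = orCoin (⋂ i ∈ K, A i) false := by
  rw [biInter_orCoin_eq_mixEv, Finset.filter_true_of_mem hF, mixEv_self]

omit [Fintype α] in
/-- A nonempty member all of whose events are mixed is fully OR-ed. [this work] -/
theorem biInter_orCoin_of_forall_true (K : Finset (Fin n)) (hF : ∀ i ∈ K, F i = true) :
    (⋂ i ∈ K, orCoin (A i) (F i)) = orCoin (⋂ i ∈ K, A i) true := by
  rw [biInter_orCoin_eq_mixEv, Finset.filter_false_of_mem (fun i hi => by simp [hF i hi]), biInter_finset_empty, mixEv_univ]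

omit [Fintype α] in
/-- Both cases at once: a member on which `F` is constant is `orCoin` of the member. [this work] -/
theorem biInter_orCoin_of_forall_eq (K : Finset (Fin n)) (b : Bool) (hF : ∀ i ∈ K, F i = b) :
    (⋂ i ∈ K, orCoin (A i) (F i)) = orCoin (⋂ i ∈ K, A i) b := by
  cases b
  · exact biInter_orCoin_of_forall_false A F K hF
  · exact biInter_orCoin_of_forall_true A F K hF

variable {μ : α → ℝ} (hμ : ∀ a, 0 ≤ μ a) (hμ1 : ∑ a, μ a = 1)
include hμ hμ1

/-- **The plain three-slot cells.**  If `F` is constant on each of the three index sets, the three-slot row of the mixed ∩-closed family is the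
three-event OR-mixture cell of `…SahiMixtureLawCells` on the members `A_{K_0}, A_{K_1}, A_{K_2}` — Bernstein-positive from their pair covariances and
cubic row, all supplied by the hereditary class. [this work] -/
theorem bernsteinPos_threeSlot_plain (hA : HereditaryAllOrders μ A) (K : Fin 3 → Finset (Fin n)) (b : Fin 3 → Bool)
    (hF : ∀ j, ∀ i ∈ K j, F i = b j) :
    BernsteinPos 3 (fun h => sahiE (coinWeight μ h) 3 (fun j => ind (⋂ i ∈ K j, orCoin (A i) (F i)))) := by
  have e : (fun j => ind (⋂ i ∈ K j, orCoin (A i) (F i))) =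
      ![ind (orCoin (⋂ i ∈ K 0, A i) (b 0)), ind (orCoin (⋂ i ∈ K 1, A i) (b 1)), ind (orCoin (⋂ i ∈ K 2, A i) (b 2))] := by
    funext j
    fin_cases j
    · exact congrArg ind (biInter_orCoin_of_forall_eq A F (K 0) (b 0) (hF 0))
    · exact congrArg ind (biInter_orCoin_of_forall_eq A F (K 1) (b 1) (hF 1))
    · exact congrArg ind (biInter_orCoin_of_forall_eq A F (K 2) (b 2) (hF 2))
  have hcov : ∀ R S : Finset (Fin n),
      ex μ (ind (⋂ i ∈ R, A i)) * ex μ (ind (⋂ i ∈ S, A i)) ≤ ex μ (ind (⋂ i ∈ R, A i) * ind (⋂ i ∈ S, A i)) := by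
    intro R S
    have h2 := hA 2 ![R, S]
    rw [sahiE_two_apply] at h2
    simp only [Matrix.cons_val_zero, Matrix.cons_val_one] at h2
    linarith
  have hE3 : 0 ≤ sahiE μ 3 ![ind (⋂ i ∈ K 0, A i), ind (⋂ i ∈ K 1, A i), ind (⋂ i ∈ K 2, A i)] := by
    rw [← fam3 A (K 0) (K 1) (K 2)]
    exact hA 3 _
  simp only [e]
  exact bernsteinPos_three_orCoin hμ hμ1 _ _ _ (hcov _ _) (hcov _ _) (hcov _ _) hE3 (b 0) (b 1) (b 2)

end Plain

end SahiMixture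

end Summit.CriticalPhenomena.PercolationContinuityZ3.Theorems

end
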